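import Summits.QuantumFields.YangMills.Theorems.AlphaInputsT3ACv3StepLowPrint
import Summits.QuantumFields.YangMills.Theorems.AlphaInputsT3ACv3LaneCore
import HarnessLib

/-!
# `AlphaInputsT3ACv3LaneChi` — THE VERSION-3 (α) INPUT PACKAGE OF THE LANE WITH PRINT'S LOWER ROW («R-57χ», owner RULING g23-№2 + ADDENDA 1–5,
# cell ym3-torus, 2026-08-27; ADDITIVE form per ADDENDUM 2): `AlphaV3AC.StepAlphaV3AC` with its (β) residual R3D-02 `fibre57Low : Bound55AC.Fibre57LowAC …`
# (the lower step bound displayed with the tower's (4) FIELD window on the left AND inside the fibre integral — false for Bałaban's objects at block sizes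
# `L ∈ {3,5}`, cell finding #44 / F-r1-g2-1) REPLACED by `fibre57LowOn : PinnedStep.Fibre57LowOnAC … (PinnedStep.loPrintAC …) k` — print's own row of (37) p.265 /
# p.272 L32–33 with print's χ (the MINIMISER window of (47) p.267, window constant 1, inside the (4)-window) on both sides; every other row VERBATIM — lane
# `pub-balaban3d`, seat alpha-1 (g9)

WHY a NEW record (and not an edit of `StepAlphaV3AC`): the director's Q-57χ-1 ruling (owner ADDENDUM 2): the old record, its rows, its chain and the five history skeletons
that consume the full-window lower envelope stay byte-unchanged and elaborating; print's row lands under new names; the registered stub 2′ becomes 2′χ naming the new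
record.  ONE source of truth for every other row: the 23 rows below are `StepAlphaV3AC`'s field texts by name (the (55)-row `fibre55Win` refers to `PinnedStep.Fibre55WinAC`,
so the R-g18-a/B2 body is inherited), the window family `win` and the data `𝔊, 𝔠, X, 𝔖, 𝔄` are the same binders.

CONTENTS (HYPOTHESIS SCHEMAS are `structure … : Prop`, never asserted; everything else is proved; print's validity family `PinnedStep.loPrintAC` «(4)-window ∧ χ_k of (47)» is
`AlphaInputsT3ACv3StepLowPrint`'s): the row-stable DATA CORE `StepAlphaV3CoreAC`/`RunAlphaV3CoreAC` with the seven χ-free leaves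
and the exponent bookkeeping is `AlphaInputsT3ACv3LaneCore`'s): §1 the χ-record `StepAlphaV3ChiAC extends StepAlphaV3CoreAC` (+ `fibre57LowOn`; field names of `StepAlphaV3AC` unchanged
but `fibre57Low ↦ fibre57LowOn`, owner ADDENDUM 6 §2) / `RunAlphaV3ChiAC`, projection `RunAlphaV3ChiAC.toCore`; §2 **(47) ON PRINT'S VALIDITY FAMILY, `dV`-a.e., every `j ≤ K`, from the
χ-record's rows** (`ineq47On_ae_of_alphaV3Chi` = `PinnedStep.ineq47On_ae` fed by the rows, the leaves and the data rows) and its restriction to any smaller family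
(`ineq47On_ae_mono` — the T³ socket takes the c-INTERIOR of the window, which lies in print's family by the record's minimiser row r1).
L-floor: the lane's `Odd L ∧ 1 < L`.

References: T. Bałaban, Commun. Math. Phys. 102 (1985) 255–275 [Balaban1985UV3]; Commun. Math. Phys. 102 (1985) 277–309 [Balaban1985Variational].
-/

set_option autoImplicit false

noncomputable section

namespace Summit.QuantumFields.YangMills.Theorems.AlphaV3AC

open MeasureTheory Metric
open scoped BigOperators Matrix.Norms.L2Operator
open Literature.MathematicalPhysics.QuantumFieldTheory.Balaban1983to89
open Literature.MathematicalPhysics.QuantumFieldTheory.Balaban1983to89.B10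
open Literature.MathematicalPhysics.QuantumFieldTheory.Balaban1983to89.B10SectAGathering
open Literature.MathematicalPhysics.QuantumFieldTheory.Balaban1983to89.B10SectCExpansion (Bound44)
open Literature.MathematicalPhysics.QuantumFieldTheory.Balaban1983to89.B10Eq24Cumulant (chiMeasure)
open Literature.MathematicalPhysics.QuantumFieldTheory.Balaban1983to89.TreeLengthTorus (tsys)
open Literature.MathematicalPhysics.QuantumFieldTheory.Balaban1985CMP102
open Literature.MathematicalPhysics.QuantumFieldTheory.Balaban1985CMP102.Setting
open Literature.MathematicalPhysics.QuantumFieldTheory.Balaban1985CMP102.Binders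
  (ChartAnalyticityAsCited FarTermsDecayAsCited Norm35StepAsCited LogZTExtensiveAsCited GraphRep23AsCited)
open Summit.QuantumFields.Balaban3D.Carriers
open Summit.QuantumFields.Balaban3D.Proofs.ScalesArithmetic (gk_pos gk_le_one)
open Summit.QuantumFields.Balaban3D.Proofs.Inputs
open Summit.QuantumFields.Balaban3D.Proofs.Primitives
open Summit.QuantumFields.Balaban3D.Proofs.UVStability3DInputs (adjAct hdet_adjAct)
open Summit.QuantumFields.Balaban3D.Proofs.Representation33 (jet26)
open Summit.QuantumFields.Balaban3D.Proofs.LiftBridge (liftCfg)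
open Summit.QuantumFields.Balaban3D.Proofs.Run3SmallFactors (codeZ)
open Summit.QuantumFields.Balaban3D.Proofs.GroupModelLieC (lieC)
open Summit.QuantumFields.Balaban3D.Proofs.FamilyLE (thresholds_of_le)
open Summit.QuantumFields.Balaban3D.Proofs.TowerAC
open Summit.QuantumFields.Balaban3D.Proofs.SeriesAC
open Summit.QuantumFields.Balaban3D.Proofs.StandardAC
open Summit.QuantumFields.Balaban3D.Proofs.InputsAC
open Summit.QuantumFields.Balaban3D.Proofs.Bound55AC
open Summit.QuantumFields.Balaban3D.Proofs.AlphaAC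
open Summit.QuantumFields.Balaban3D.Proofs.AlphaAdaptersAC
open Summit.QuantumFields.Balaban3D.Proofs.Thm2AC (oldOutside_piecesAC step0_towerOfAC)
open B7Prop1Explicit (hol plaqWord)
open B7Prop1Local (pdevOn loK plaqHiK)
open B7Prop2Explicit (avgIter)

variable {L : ℕ}

/-! ## §1 The χ-record: step and run packages -/

section Alpha

variable {S : Scales L} {G : Type} [GaugeGroup G] [MeasurableSpace G] [HaarData G] (𝔊 : GroupModel G) (𝔠 : AlphaConsts L 𝔊.N)
  (X : ExternalInputsAC S G) (𝔖 : ∀ k, StepSeries S G ↥(lieC 𝔊) (nblkOf S 𝔠.lane.carrier k) k) (𝔄 : AlphaDataAC 𝔊 𝔠 X 𝔖)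
  (win : (k : ℕ) → Hist S.P (k + 1) → Set (GaugeField S.P (k + 1) G))

open Classical in
/-- **THE VERSION-3 (α) INPUTS OF STEP `k → k+1` WITH PRINT'S LOWER ROW** (the χ-record): the core rows and, in place of the lane's R3D-02 `fibre57Low : Bound55AC.Fibre57LowAC …`
(tower's (4) field window on both sides — retired from the live DAG, owner ADDENDUM 2 §3), the row `fibre57LowOn`: [Balaban1985UV3] p.272 L32–33 / (37) p.265 with PRINT'S χ — the
validity family `PinnedStep.loPrintAC` («χ_k corresponds to the restrictions on V given by the conditions |U_k(∂p) − 1| < g_kp(g_k)η²», (47) p.267, on the input's own minimiser, inside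
the (4)-window) — on the LEFT at level `k+1` and INSIDE the fibre integral at level `k` (`PinnedStep.Fibre57LowOnAC`).  Field names of `StepAlphaV3AC` unchanged but `fibre57Low ↦ fibre57LowOn`.
HYPOTHESES; nothing asserted. [cite: Balaban1985UV3, p.265 L21–28 + (47) p.267 + p.272 L32–33] -/
structure StepAlphaV3ChiAC (k : ℕ) : Prop extends StepAlphaV3CoreAC 𝔊 𝔠 X 𝔖 𝔄 win k where
  /-- RESIDUAL R3D-02χ: print's lower step bound at the trivial history, print's χ (minimiser window inside the (4)-window) on both sides -/
  fibre57LowOn : PinnedStep.Fibre57LowOnAC 𝔠.lane X 𝔖 (PinnedStep.loPrintAC 𝔠.lane X) k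

/-- **THE VERSION-3 (α) INPUTS OF ONE LATTICE APPROXIMATION WITH PRINT'S LOWER ROW**: the χ-record's step inputs for every `k < K`; (67), (68) — `RunAlphaV3AC`'s text with
`StepAlphaV3AC ↦ StepAlphaV3ChiAC`.  HYPOTHESES. [cite: Balaban1985UV3, (67)–(68) p.273 + pp.273–274] -/
structure RunAlphaV3ChiAC : Prop where
  /-- the step inputs -/
  steps : ∀ k, k + 1 ≤ S.K → StepAlphaV3ChiAC 𝔊 𝔠 X 𝔖 𝔄 win k
  /-- (67) ∘ the large-field characteristic function of the history, on the averaged lifted minimizers -/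
  hLF67 : ∀ k, k ≤ S.K → ∀ (h : Hist S.P k), Hist.Admissible 𝔠.lane.carrier.M₁ (rcolOf S 𝔠.lane.carrier) k h →
    ∀ (U : GaugeField S.P k G), ∀ e ∈ Hist.disc h, S.gk e.1 * pFun 𝔠.lane.carrier.b₀ 𝔠.lane.carrier.p₀ (S.gk e.1) ≤
      ‖((hol (avgIter L (liftCfg 𝔊 (X.UkH k h U)) e.1) (codeZ e) (plaqWord e.2.2.1 e.2.2.2) :
          (Matrix (Fin 𝔊.N) (Fin 𝔊.N) ℂ)ˣ) : Matrix (Fin 𝔊.N) (Fin 𝔊.N) ℂ) - 1‖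
  /-- (68) on the lifted minimizers -/
  h68 : ∀ k, k ≤ S.K → ∀ (h : Hist S.P k), Hist.Admissible 𝔠.lane.carrier.M₁ (rcolOf S 𝔠.lane.carrier) k h →
    ∀ (U : GaugeField S.P k G), ∀ e ∈ Hist.disc h,
      pdevOn (loK L e.1 (codeZ e)) (plaqHiK L e.1 (codeZ e) e.2.2.1 e.2.2.2) (liftCfg 𝔊 (X.UkH k h U)) <
        𝔠.C68 * (S.gk e.1 * pFun 𝔠.lane.carrier.b₀ 𝔠.lane.carrier.p₀ (S.gk e.1)) * (((L : ℝ) ^ e.1)⁻¹) ^ 2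


variable {𝔊 𝔠 X 𝔖 𝔄 win}

/-- The χ-record projects to the core. [folklore] -/
theorem RunAlphaV3ChiAC.toCore (R : RunAlphaV3ChiAC 𝔊 𝔠 X 𝔖 𝔄 win) : RunAlphaV3CoreAC 𝔊 𝔠 X 𝔖 𝔄 win :=
  ⟨fun k hk => (R.steps k hk).toStepAlphaV3CoreAC, R.hLF67, R.h68⟩

end Alpha

/-! ## §2 (47) on print's validity family from the χ-record's rows -/

section AlphaTower

variable {S : Scales L} {G : Type} [GaugeGroup G] [MeasurableSpace G] [HaarData G] {𝔊 : GroupModel G} {𝔠 : AlphaConsts L 𝔊.N}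
  {X : ExternalInputsAC S G} {𝔖 : ∀ k, StepSeries S G ↥(lieC 𝔊) (nblkOf S 𝔠.lane.carrier k) k} {𝔄 : AlphaDataAC 𝔊 𝔠 X 𝔖}
  {win : (k : ℕ) → Hist S.P (k + 1) → Set (GaugeField S.P (k + 1) G)}
  (hle : S.g ^ 2 * S.ε₀ ≤ (min 𝔠.gamma0 1) ^ 2)
include hle

/-- **BAŁABAN CMP 102 (47) ON PRINT'S VALIDITY FAMILY, `dV`-A.E., EVERY `j ≤ K`, MODULO THE χ-RECORD'S ROWS**: on the `≤`-family `g²ε₀ ≤ (min γ₀ 1)²`, `RunAlphaV3ChiAC` gives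
`𝟙[loPrintAC j](V)·exp(−mainT_j(triv,V) + Pint_j(triv,V) − E_j − Rm_j) ≤ ρ_j(V)` for `dV`-a.e. `V` (`PinnedStep.ineq47On_ae` fed by the rows `fibre57LowOn`, the χ-free exponent step
from the seven leaves, the data rows `hU`/`hPm`/`hPb`, and the measurability of print's family from `hU`).  This is print's (47) p.267 with print's χ_j, for the lane's AC tower.
[cite: Balaban1985UV3, (47) p.267 + p.272 L32–33 + Thm 2 p.272] -/
theorem ineq47On_ae_of_alphaV3Chi (R : RunAlphaV3ChiAC 𝔊 𝔠 X 𝔖 𝔄 win)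
    (hUK : Measurable (X.UkH S.K (Hist.triv S.P S.K))) (hPmK : Measurable ((inputOfAC 𝔠.lane X 𝔖).Pint S.K (Hist.triv S.P S.K)))
    (hPbK : ∀ U : GaugeField S.P S.K G, (inputOfAC 𝔠.lane X 𝔖).Pint S.K (Hist.triv S.P S.K) U ≤ 𝔄.cP S.K) :
    ∀ j : ℕ, j ≤ S.K → ∀ᵐ V ∂(fieldMeasure S.P j G),
      (PinnedStep.loPrintAC 𝔠.lane X j).indicator (fun _ => (1 : ℝ)) V *
          Real.exp (-((towerOfAC 𝔠.lane X 𝔖).mainT j (Hist.triv S.P j) V) + (towerOfAC 𝔠.lane X 𝔖).Pint j (Hist.triv S.P j) V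
            - (towerOfAC 𝔠.lane X 𝔖).Ecst j - (towerOfAC 𝔠.lane X 𝔖).Rm j) ≤ (towerOfAC 𝔠.lane X 𝔖).ρ j V := by
  haveI : RegularGaugeGroup G := groupModel_regularGaugeGroup 𝔊
  have RC := R.toCore
  -- the data rows at every `k ≤ K` (step rows for `k < K`, terminal rows at `k = K`)
  have hU : ∀ k, k ≤ S.K → Measurable (X.UkH k (Hist.triv S.P k)) := fun k hk => by
    rcases Nat.lt_or_eq_of_le hk with hlt | heq
    · exact (RC.steps k hlt).hU _
    · subst heq; exact hUK
  have hPm : ∀ k, k ≤ S.K → Measurable ((inputOfAC 𝔠.lane X 𝔖).Pint k (Hist.triv S.P k)) := fun k hk => by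
    rcases Nat.lt_or_eq_of_le hk with hlt | heq
    · exact (RC.steps k hlt).hPm _
    · subst heq; exact hPmK
  have hPb : ∀ k, k ≤ S.K → ∃ cP : ℝ, ∀ U : GaugeField S.P k G, (inputOfAC 𝔠.lane X 𝔖).Pint k (Hist.triv S.P k) U ≤ cP := fun k hk => by
    rcases Nat.lt_or_eq_of_le hk with hlt | heq
    · exact ⟨𝔄.cP k, fun U => (RC.steps k hlt).hPb _ U⟩
    · subst heq; exact ⟨𝔄.cP S.K, hPbK⟩
  exact PinnedStep.ineq47On_ae 𝔠.lane X 𝔖 (PinnedStep.loPrintAC 𝔠.lane X)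
    (fun k hk => PinnedStep.measurableSet_loPrintAC 𝔠.lane X k (hU k hk))
    (fun k hk => (R.steps k hk).fibre57LowOn)
    (fun k hk V => expo47_succ_le_expo57_CoreAC 𝔠.lane X 𝔖 k hk (stepResidualsV3Core_of_alpha hle k hk (RC.steps k hk)) V)
    hU hPm hPb

omit hle in
/-- **RESTRICTION TO A SMALLER FAMILY**: the a.e. (47) on print's family gives the a.e. (47) with the indicator of any `lo′ j ⊆ loPrintAC j` (`𝟙[lo′] ≤ 𝟙[loPrint]`) — the form a
FIELD-window reader uses (the T³ socket: `lo′ j :=` the interior window `g_jp(g_j)/max(B₃,1)`, inside print's family by the record's minimiser row r1,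
`PinnedStep.plaqSmall_subset_loPrintAC`). [cite: Balaban1985Variational, Thm 1 (8) p.279] -/
theorem ineq47On_ae_mono {lo' : (k : ℕ) → Set (GaugeField S.P k G)} (j : ℕ) (hsub : lo' j ⊆ PinnedStep.loPrintAC 𝔠.lane X j)
    (h : ∀ᵐ V ∂(fieldMeasure S.P j G),
      (PinnedStep.loPrintAC 𝔠.lane X j).indicator (fun _ => (1 : ℝ)) V *
          Real.exp (-((towerOfAC 𝔠.lane X 𝔖).mainT j (Hist.triv S.P j) V) + (towerOfAC 𝔠.lane X 𝔖).Pint j (Hist.triv S.P j) V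
            - (towerOfAC 𝔠.lane X 𝔖).Ecst j - (towerOfAC 𝔠.lane X 𝔖).Rm j) ≤ (towerOfAC 𝔠.lane X 𝔖).ρ j V) :
    ∀ᵐ V ∂(fieldMeasure S.P j G),
      (lo' j).indicator (fun _ => (1 : ℝ)) V *
          Real.exp (-((towerOfAC 𝔠.lane X 𝔖).mainT j (Hist.triv S.P j) V) + (towerOfAC 𝔠.lane X 𝔖).Pint j (Hist.triv S.P j) V
            - (towerOfAC 𝔠.lane X 𝔖).Ecst j - (towerOfAC 𝔠.lane X 𝔖).Rm j) ≤ (towerOfAC 𝔠.lane X 𝔖).ρ j V := by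
  filter_upwards [h] with V hV
  exact le_trans (mul_le_mul_of_nonneg_right (Set.indicator_le_indicator_of_subset hsub (fun _ => zero_le_one) V) (Real.exp_pos _).le) hV

end AlphaTower

end Summit.QuantumFields.YangMills.Theorems.AlphaV3AC

end
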